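import Literature.Computability.QuantumComplexity.ReversibleCliffordT
import Literature.Computability.Cryptography.QuantumCircuitProofs
import Literature.Computability.Cryptography.QubitRegisterCliffordTProofs
import HarnessLib

/-!
# Path sums for Clifford+T circuits and the sign of the Adleman–DeMarrais–Huang count

Quantum half of the proof of the named fact `Literature.Computability.QuantumComplexity.BQP_subset_PP`
(`Literature/Computability/QuantumComplexity/BQP.lean`; Adleman–DeMarrais–Huang 1997, Thm. 6.4
and Lemma 6.10: `BQP ⊆ PP`), for the tree's `BQP` (polynomial-time uniform families of
Clifford+`T` circuits, `Literature.Computability.Cryptography.BQP`). The printed proof (pp. 1534–1539) works with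
a quantum Turing machine whose amplitudes are rational (`BQP = BQP_θ`, `cos θ = 3/5`, §3), sums
the amplitudes `ρ_p` of the computational *paths* `p` leading to a configuration (p. 1535), and
counts pairs of paths with a nondeterministic machine whose "yes" minus "no" balance is
`2 d^{2t} (Σ_{C ∈ C_A} amp² − Σ_{C ∈ C_R} amp²)` (p. 1539). This file supplies the corresponding
exact statements for Clifford+`T` circuits, whose amplitudes live in `ℤ[ω]/√2^h`
(`ω = e^{iπ/4}`, `h` = number of Hadamard gates) and whose acceptance probabilities lie in
`ℤ[√2]/2^h` and are in general irrational:

* `pathStep`, `pathRun` — computational paths: one choice bit per gate (free for `H`, forced `0`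
  for `S`, `T`, `CNOT`), the endpoint label and the phase exponent `φ` (`+4` for an `H` step
  `1 → 1`, `+2` for `S` on a `1`, `+1` for `T` on a `1`); `hCount`;
* `semZeta ζ`, `prodZeta ζ` — the **`ζ`-semantics** of a gate list, in which `T` denotes
  `diag(1, ζ)`: for `ζ = ω` the circuit itself (`prodZeta_omega`), for `ζ = ω⁵ = σ(ω)` its
  conjugate under the automorphism `σ : √2 ↦ −√2` (`i` fixed) of `ℚ(ω)`; both are unitary
  (`prodZeta_mem_unitaryGroup`, `normSq_prodZeta_mulVec_basisState`);
* **path-sum theorem** `prodZeta_mulVec_basisState(_apply)`: for `ζ² = i`,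
  `⟨z|U|w⟩ = 2^{-h/2} Σ_{b : end(b) = z} ζ^{φ(b)}`;
* `pairDiff`, `pairSumA`, `pairSumB`, `two_pow_mul_normSq_amp(_omega/_omega5)`:
  `2^h |⟨z|U|w⟩|² = A_z ± (√2/2) B_z` with the integer pair counts
  `A_z = Σ_{(b,b')} reA(d)`, `B_z = Σ_{(b,b')} reB(d)` over pairs of paths ending at `z`, `d` the
  phase-difference class mod `8` (`Re ω^d = reA d + reB d · √2/2`, `omega_pow_re`);
* `accSign`, `adhA = 𝔄`, `adhB = 𝔅`, `adhW = W = 4𝔄 + 3𝔅`, `probAcc`, and the **sign theorem**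
  `adhW_pos` / `adhW_neg`: if wire `0` reads `1` with probability `≥ 2/3` then `W > 0`, if with
  probability `≤ 1/3` then `W < 0`. Proof: `𝔄 + (√2/2)𝔅 = 2^h (2p − 1)` (`adhA_add_adhB_eq`) and,
  for the conjugate semantics, `𝔄 − (√2/2)𝔅 = 2^h (2p^σ − 1) ∈ [−2^h, 2^h]`, whence
  `|𝔅| ≤ √2 · 2^h` (`abs_adhB_le`) and `W = 4 · 2^h(2p − 1) + (3 − 2√2)𝔅` has the sign of
  `p − 1/2` under the `1/3`-gap since `(3 − 2√2)√2 < 4/3`.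

The replacement of the irrational weight `√2/2` of the odd phase classes by `3/4` (the integer
weights `4 reA + 3 reB ∈ {0, ±3, ±4}`) is what makes the count realisable by a majority vote
over guessed path pairs; the counting machine, the language `adhLang F ∈ P` and the assembly of
`BQP ⊆ PP` are in `BQPSubsetPP.lean`. The conjugate-semantics bound replaces step (1) of the
printed proof (the change to rational amplitudes, which over circuits would be a gate-set
compilation); everything else follows Lemma 6.10.

## References

* L. M. Adleman, J. DeMarrais, M.-D. A. Huang, *Quantum computability*, SIAM J. Comput. 26
  (1997) 1524–1540, doi:10.1137/S0097539795293639: §6, p. 1534 (paths `P_{α,t,C}`, amplitudes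
  `ρ_p`), Lemma 6.6, p. 1535 (`amp_{α,t,C}(u) = Σ_p ρ_p`), Thm. 6.4, Lemma 6.10 and its proof,
  pp. 1538–1539.
* M. A. Nielsen, I. L. Chuang, *Quantum Computation and Quantum Information*, CUP 2010, §4.2
  (the gates `H`, `S`, `T`; `ω = e^{iπ/4}`), §2.2.5 (Born rule).
* E. Bernstein, U. Vazirani, *Quantum complexity theory*, SIAM J. Comput. 26 (1997), §8.

## Design notes

* Everything is stated for gate *lists* `List (QGate cliffordT N)` (the `gates` of a
  `QCircuit`), head = first gate, matching `QCircuit.toMatrix`.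
* General placements `e : Fin (arity g) ↪ Fin N` are retyped (`embH`, …, definitional) and
  normalised to the tree's `wireEmb`/`pairEmb` (`emb_one_eq_wireEmb`, `emb_two_eq_pairEmb`) so
  that the basis-state lemmas of `ReversibleCliffordT.lean` apply.
* Oracle gates admit no path step; all statements about semantics assume oracle-freeness (as
  `BQP` does).
-/

noncomputable section

namespace Literature.Computability.QuantumComplexity

open _root_.Computability Complexity Cryptography Matrix

variable {N : ℕ}

/-! ### Retyping gate placements -/

/-- The placement of an `H` gate as an embedding `Fin 1 ↪ Fin N` (definitional retyping, so
that `e 0` elaborates). [folklore] -/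
abbrev embH (e : Fin (cliffordT.arity CliffordTOp.H) ↪ Fin N) : Fin 1 ↪ Fin N := e

/-- The placement of an `S` gate as an embedding `Fin 1 ↪ Fin N`. [folklore] -/
abbrev embS (e : Fin (cliffordT.arity CliffordTOp.S) ↪ Fin N) : Fin 1 ↪ Fin N := e

/-- The placement of a `T` gate as an embedding `Fin 1 ↪ Fin N`. [folklore] -/
abbrev embT (e : Fin (cliffordT.arity CliffordTOp.T) ↪ Fin N) : Fin 1 ↪ Fin N := e

/-- The placement of a `CNOT` gate as an embedding `Fin 2 ↪ Fin N`. [folklore] -/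
abbrev embC (e : Fin (cliffordT.arity CliffordTOp.CNOT) ↪ Fin N) : Fin 2 ↪ Fin N := e

/-- An embedding `Fin 1 ↪ Fin N` is the single-wire embedding of its value. [folklore] -/
theorem emb_one_eq_wireEmb (e : Fin 1 ↪ Fin N) : e = wireEmb (e 0) := by
  ext i
  rw [Subsingleton.elim i 0, wireEmb_apply]

/-- The two wires of an embedding `Fin 2 ↪ Fin N` are distinct. [folklore] -/
theorem emb_two_ne (e : Fin 2 ↪ Fin N) : e 0 ≠ e 1 := fun h => by
  have := e.injective h
  exact absurd this (by decide)

/-- An embedding `Fin 2 ↪ Fin N` is the pair embedding of its two values. [folklore] -/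
theorem emb_two_eq_pairEmb (e : Fin 2 ↪ Fin N) : e = pairEmb (e 0) (e 1) (emb_two_ne e) := by
  ext i
  fin_cases i <;> rfl

/-! ### Classical path steps through Clifford+T gates -/

/-- **One step of a computational path** through a placed Clifford+T gate, driven by one
choice bit `c`: from the basis label `w`, an `H` gate on wire `i` moves to `w[i ↦ c]` and picks
up the phase exponent `4` (i.e. the sign `ω⁴ = -1`) iff `w i = c = 1`; the diagonal gates `S`,
`T` keep `w` and pick up the exponents `2 [w i]`, `[w i]` of `ω = e^{iπ/4}`; `CNOT` moves to
`w[j ↦ w j ⊕ w i]`; for the non-branching gates the choice bit must be `0` (otherwise the step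
is invalid, `none`), and oracle gates admit no step. This is the circuit form of the paths
`⟨C₀, …, C_t⟩` of Adleman–DeMarrais–Huang (a path is specified by the sequence of choices of an
entry in the column of the local matrix). [cite: AdlemanDeMarraisHuang1997, §6 (p. 1534, paths P_{α,t,C}; p. 1536, paths coded by numbers P < n^t)] -/
def pathStep : QGate cliffordT N → Bool → QReg N → Option (QReg N × ℕ)
  | .gate .H e, c, w =>
      some (Function.update w (embH e 0) c, if w (embH e 0) && c then 4 else 0)
  | .gate .S e, c, w => if c then none else some (w, if w (embS e 0) then 2 else 0)
  | .gate .T e, c, w => if c then none else some (w, if w (embT e 0) then 1 else 0)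
  | .gate .CNOT e, c, w =>
      if c then none else
        some (Function.update w (embC e 1) (w (embC e 1) ^^ w (embC e 0)), 0)
  | .oracle _ _, _, _ => none

/-- **A computational path** through a gate list (head = first gate), driven by one choice bit
per gate: the final basis label and the total phase exponent of `ω`, or `none` if some step is
invalid or the number of choice bits is not the number of gates.
[cite: AdlemanDeMarraisHuang1997, §6 (p. 1534, paths and their amplitudes ρ_p)] -/
def pathRun : List (QGate cliffordT N) → QReg N → List Bool → Option (QReg N × ℕ)
  | [], w, [] => some (w, 0)
  | [], _, _ :: _ => none
  | _ :: _, _, [] => none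
  | g :: gs, w, c :: cs =>
      match pathStep g c w with
      | none => none
      | some (w', φ) => (pathRun gs w' cs).map fun r => (r.1, φ + r.2)

/-- Is the placed gate a Hadamard gate (the only branching gate of Clifford+T)? [folklore] -/
def QGateIsH : QGate cliffordT N → Bool
  | .gate .H _ => true
  | .gate .S _ => false
  | .gate .T _ => false
  | .gate .CNOT _ => false
  | .oracle _ _ => false

/-- The number of Hadamard gates in a gate list (`h`; every path amplitude has modulus
`2^{-h/2}`). [cite: AdlemanDeMarraisHuang1997, §6 Lemma 6.6 (the common denominator d^t of path amplitudes)] -/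
def hCount (gs : List (QGate cliffordT N)) : ℕ := gs.countP fun g => QGateIsH g

/-- The empty list has no Hadamard gate. [folklore] -/
@[simp] theorem hCount_nil : hCount ([] : List (QGate cliffordT N)) = 0 := rfl

/-- Hadamard count of a cons. [folklore] -/
theorem hCount_cons (g : QGate cliffordT N) (gs : List (QGate cliffordT N)) :
    hCount (g :: gs) = hCount gs + (if QGateIsH g then 1 else 0) := by
  simp [hCount, List.countP_cons]

/-- `h ≤` the number of gates. [folklore] -/
theorem hCount_le_length (gs : List (QGate cliffordT N)) : hCount gs ≤ gs.length :=
  List.countP_le_length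

/-- The amplitude factor contributed by one gate: `1/√2` for `H`, `1` otherwise. [folklore] -/
def hCoef (g : QGate cliffordT N) : ℂ := if QGateIsH g then invSqrt2 else 1

/-! ### The `ζ`-semantics: `T ↦ diag(1, ζ)` -/

/-- The one-qubit phase gate `diag(1, ζ)`. For `ζ = ω = e^{iπ/4}` this is the `T` gate; for
`ζ = ω⁵` its Galois conjugate under `√2 ↦ -√2` (`i` fixed). [Nielsen–Chuang 2010, §4.2]
[folklore] -/
def phaseGate (ζ : ℂ) : Matrix (QReg 1) (QReg 1) ℂ :=
  Matrix.of fun x y => if x = y then (if x 0 = true then ζ else 1) else 0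

/-- The `T` gate is `diag(1, ω)`. [Nielsen–Chuang 2010, §4.2] [folklore] -/
theorem tGate_eq_phaseGate : tGate = phaseGate omega := rfl

/-- The **`ζ`-semantics** of a placed Clifford+T gate: the usual matrix, except that a `T`
gate denotes `diag(1, ζ)` (oracle gates: the empty oracle). For `ζ = ω` this is the ordinary
semantics of oracle-free gates (`semZeta_omega`); for `ζ = ω⁵` it is the conjugate circuit used
to bound the irrational part of Clifford+T acceptance probabilities. [folklore] -/
def semZeta (ζ : ℂ) : QGate cliffordT N → Matrix (QReg N) (QReg N) ℂ
  | .gate .T e => placeGate (embT e) (phaseGate ζ)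
  | .gate .H e => (QGate.gate CliffordTOp.H e : QGate cliffordT N).toMatrix 0
  | .gate .S e => (QGate.gate CliffordTOp.S e : QGate cliffordT N).toMatrix 0
  | .gate .CNOT e => (QGate.gate CliffordTOp.CNOT e : QGate cliffordT N).toMatrix 0
  | .oracle k e => (QGate.oracle k e : QGate cliffordT N).toMatrix 0

/-- The `ζ`-semantics of a gate list: the product with the first gate rightmost (as
`QCircuit.toMatrix`). [folklore] -/
def prodZeta (ζ : ℂ) (gs : List (QGate cliffordT N)) : Matrix (QReg N) (QReg N) ℂ :=
  (gs.map (semZeta ζ)).reverse.prod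

/-- The empty product. [folklore] -/
@[simp] theorem prodZeta_nil (ζ : ℂ) : prodZeta ζ ([] : List (QGate cliffordT N)) = 1 := by
  simp [prodZeta]

/-- Prepending a gate: it is the rightmost factor. [folklore] -/
theorem prodZeta_cons (ζ : ℂ) (g : QGate cliffordT N) (gs : List (QGate cliffordT N)) :
    prodZeta ζ (g :: gs) = prodZeta ζ gs * semZeta ζ g := by
  simp [prodZeta]

/-- For `ζ = ω` the `ζ`-semantics of an oracle-free gate is its semantics. [folklore] -/
theorem semZeta_omega (A : Language Bool) {g : QGate cliffordT N} (hg : g.IsOracleFree) :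
    semZeta omega g = g.toMatrix A := by
  cases g with
  | gate g e =>
    cases g
    · exact QGate.toMatrix_eq_of_isOracleFree hg 0 A
    · exact QGate.toMatrix_eq_of_isOracleFree hg 0 A
    · rfl
    · exact QGate.toMatrix_eq_of_isOracleFree hg 0 A
  | oracle k e => exact absurd hg id

/-- For `ζ = ω` the `ζ`-semantics of an oracle-free circuit is its matrix. [folklore] -/
theorem prodZeta_omega (A : Language Bool) {C : QCircuit cliffordT N} (hC : C.IsOracleFree) :
    prodZeta omega C.gates = C.toMatrix A := by
  obtain ⟨gs⟩ := C
  induction gs with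
  | nil => simp
  | cons g gs ih =>
    have hg : g.IsOracleFree := hC g (by simp)
    have hgs : (⟨gs⟩ : QCircuit cliffordT N).IsOracleFree := fun g' hg' => hC g' (by simp [hg'])
    rw [prodZeta_cons, QCircuit.toMatrix_cons, ih hgs, semZeta_omega A hg]

/-! ### One gate on a basis state, as a sum over the choice bit -/

section OneGate

variable (ζ : ℂ)

/-- The vector contributed by the step of gate `g` with choice bit `c` from `|w⟩`:
`(hCoef g · ζ^φ) |w'⟩` if the step is valid with target `w'` and phase exponent `φ`, else `0`.
[folklore] -/
def stepVec (g : QGate cliffordT N) (c : Bool) (w : QReg N) : QReg N → ℂ :=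
  match pathStep g c w with
  | none => 0
  | some (w', φ) => (hCoef g * ζ ^ φ) • basisState w'

/-- A placed `S` gate is `sOn` of its wire. [folklore] -/
theorem gateS_eq_sOn (e : Fin (cliffordT.arity CliffordTOp.S) ↪ Fin N) :
    (QGate.gate CliffordTOp.S e : QGate cliffordT N) = sOn (embS e 0) := by
  unfold sOn
  exact congrArg _ (emb_one_eq_wireEmb (embS e))

/-- A placed `H` gate is `hOn` of its wire. [folklore] -/
theorem gateH_eq_hOn (e : Fin (cliffordT.arity CliffordTOp.H) ↪ Fin N) :
    (QGate.gate CliffordTOp.H e : QGate cliffordT N) = hOn (embH e 0) := by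
  unfold hOn
  exact congrArg _ (emb_one_eq_wireEmb (embH e))

/-- A placed `CNOT` gate is `cnotOn` of its two wires. [folklore] -/
theorem gateCNOT_eq_cnotOn (e : Fin (cliffordT.arity CliffordTOp.CNOT) ↪ Fin N) :
    (QGate.gate CliffordTOp.CNOT e : QGate cliffordT N) =
      cnotOn (embC e 0) (embC e 1) (emb_two_ne (embC e)) := by
  unfold cnotOn
  exact congrArg _ (emb_two_eq_pairEmb (embC e))

variable {ζ}

/-- `ζ² = i` gives `ζ⁴ = -1`. [folklore] -/
theorem zeta_pow_four (hζ : ζ ^ 2 = Complex.I) : ζ ^ 4 = -1 := by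
  rw [show (4 : ℕ) = 2 * 2 from rfl, pow_mul, hζ, Complex.I_sq]

/-- **One gate as a two-term path sum.** For `ζ² = i` and an oracle-free gate `g`,
`semZeta ζ g |w⟩ = ∑_{c ∈ {0,1}} stepVec ζ g c w`. [Nielsen–Chuang 2010, §4.2 (actions of
`H`, `S`, `T`, `CNOT` on basis states)] [folklore] -/
theorem semZeta_mulVec_basisState (hζ : ζ ^ 2 = Complex.I) {g : QGate cliffordT N}
    (hg : g.IsOracleFree) (w : QReg N) :
    semZeta ζ g *ᵥ basisState w = ∑ c : Bool, stepVec ζ g c w := by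
  rw [Fintype.sum_bool]
  cases g with
  | oracle k e => exact absurd hg id
  | gate g e =>
    cases g with
    | H =>
      simp only [semZeta, stepVec, pathStep, hCoef, QGateIsH]
      conv_lhs => rw [gateH_eq_hOn, hOn_mulVec_basisState' 0 (embH e 0) w]
      cases w (embH e 0)
      · simp only [Bool.false_and, Bool.false_eq_true, if_false, if_true, pow_zero, mul_one,
          one_smul, smul_add]
        rw [add_comm]
      · simp only [Bool.true_and, if_true, Bool.false_eq_true, if_false, pow_zero, mul_one,
          smul_add, smul_smul, zeta_pow_four hζ]
        rw [add_comm]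
    | S =>
      simp only [semZeta, stepVec, pathStep, hCoef, QGateIsH]
      conv_lhs => rw [gateS_eq_sOn, sOn_mulVec_basisState 0 (embS e 0) w]
      cases w (embS e 0) <;> simp [hζ]
    | T =>
      simp only [semZeta]
      rw [emb_one_eq_wireEmb (embT e), placeGate_wireEmb_mulVec_basisState]
      simp only [stepVec, pathStep, hCoef, QGateIsH, if_true]
      cases hw : w (embT e 0)
      · have h1 : Function.update w (embT e 0) false = w := by rw [← hw, Function.update_eq_self]
        simp [phaseGate, funext_iff, h1]
      · have h1 : Function.update w (embT e 0) true = w := by rw [← hw, Function.update_eq_self]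
        simp [phaseGate, funext_iff, h1]
    | CNOT =>
      simp only [semZeta, stepVec, pathStep, hCoef, QGateIsH]
      conv_lhs => rw [gateCNOT_eq_cnotOn, cnotOn_mulVec_basisState 0]
      simp

end OneGate

/-! ### The path sum of a gate list -/

section PathSum

variable (ζ : ℂ)

/-- The vector contributed by the path with choice bits `bs` from `|w⟩` through `gs`:
`(2^{-h/2} ζ^φ) |z⟩` if the path is valid with endpoint `z` and phase exponent `φ`
(`h` = number of Hadamard gates), and `0` otherwise.
[cite: AdlemanDeMarraisHuang1997, §6 Lemma 6.6 (path amplitudes ρ_p = (a_p/d^t)·β^i)] -/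
def pathAmp (gs : List (QGate cliffordT N)) (w : QReg N) (bs : List Bool) : QReg N → ℂ :=
  match pathRun gs w bs with
  | none => 0
  | some (z, φ) => (invSqrt2 ^ hCount gs * ζ ^ φ) • basisState z

/-- The empty path. [folklore] -/
@[simp] theorem pathAmp_nil_nil (w : QReg N) : pathAmp ζ [] w [] = basisState w := by
  simp [pathAmp, pathRun]

/-- Peeling the first step off a path amplitude. [folklore] -/
theorem pathAmp_cons (g : QGate cliffordT N) (gs : List (QGate cliffordT N)) (w : QReg N)
    (c : Bool) (bs : List Bool) :
    pathAmp ζ (g :: gs) w (c :: bs) =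
      match pathStep g c w with
      | none => 0
      | some (w', φ) => (hCoef g * ζ ^ φ) • pathAmp ζ gs w' bs := by
  unfold pathAmp
  simp only [pathRun]
  cases pathStep g c w with
  | none => rfl
  | some p =>
    obtain ⟨w', φ⟩ := p
    simp only
    cases pathRun gs w' bs with
    | none => simp
    | some q =>
      obtain ⟨z, ψ⟩ := q
      simp only [Option.map_some, hCount_cons, smul_smul]
      congr 1
      simp only [hCoef, pow_add]
      split_ifs <;> ring

/-- **Path-sum theorem** (Feynman sum over computational paths for Clifford+T). For `ζ² = i`
and an oracle-free gate list `gs`, the `ζ`-semantics maps `|w⟩` to the sum, over all choice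
strings `b ∈ {0,1}^{|gs|}`, of the path vectors `(2^{-h/2} ζ^{φ(b)}) |end(b)⟩` of the valid
paths. This is the circuit form of "the amplitude of a configuration is the sum of the
amplitudes `ρ_p` of the paths leading to it" in Adleman–DeMarrais–Huang.
[cite: AdlemanDeMarraisHuang1997, §6 (p. 1535, amp_{α,t,C}(u) = Σ_{p ∈ P_{α,t,C}} ρ_p)] -/
theorem prodZeta_mulVec_basisState (hζ : ζ ^ 2 = Complex.I) (gs : List (QGate cliffordT N))
    (hgs : ∀ g ∈ gs, g.IsOracleFree) (w : QReg N) :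
    prodZeta ζ gs *ᵥ basisState w =
      ∑ b : Fin gs.length → Bool, pathAmp ζ gs w (List.ofFn b) := by
  induction gs generalizing w with
  | nil => simp
  | cons g gs ih =>
    have hg : g.IsOracleFree := hgs g (by simp)
    have hgs' : ∀ g' ∈ gs, g'.IsOracleFree := fun g' h => hgs g' (by simp [h])
    rw [prodZeta_cons, ← Matrix.mulVec_mulVec, semZeta_mulVec_basisState hζ hg,
      Matrix.mulVec_sum]
    rw [show (∑ b : Fin (g :: gs).length → Bool, pathAmp ζ (g :: gs) w (List.ofFn b)) =
        ∑ p : Bool × (Fin gs.length → Bool),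
          pathAmp ζ (g :: gs) w (List.ofFn (Fin.cons p.1 p.2 : Fin (gs.length + 1) → Bool)) from
      ((Fin.consEquiv fun _ => Bool).sum_comp
        (fun b : Fin (gs.length + 1) → Bool => pathAmp ζ (g :: gs) w (List.ofFn b))).symm,
      Fintype.sum_prod_type]
    refine Finset.sum_congr rfl fun c _ => ?_
    simp only [List.ofFn_cons, pathAmp_cons]
    unfold stepVec
    cases pathStep g c w with
    | none => simp
    | some p =>
      obtain ⟨w', φ⟩ := p
      simp only [Matrix.mulVec_smul, ih hgs' w', Finset.smul_sum]

/-- The scalar contributed at `z` by the path `b`: `ζ^{φ(b)}` if the path is valid and ends at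
`z`, else `0`. [cite: AdlemanDeMarraisHuang1997, §6 (p. 1534, ρ_p)] -/
def pathTerm (gs : List (QGate cliffordT N)) (w z : QReg N) (bs : List Bool) : ℂ :=
  match pathRun gs w bs with
  | none => 0
  | some (z', φ) => if z' = z then ζ ^ φ else 0

/-- Entries of a path vector. [folklore] -/
theorem pathAmp_apply (gs : List (QGate cliffordT N)) (w : QReg N) (bs : List Bool) (z : QReg N) :
    pathAmp ζ gs w bs z = invSqrt2 ^ hCount gs * pathTerm ζ gs w z bs := by
  unfold pathAmp pathTerm
  cases pathRun gs w bs with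
  | none => simp
  | some p =>
    obtain ⟨z', φ⟩ := p
    by_cases h : z' = z
    · subst h; simp
    · simp [h, Ne.symm h]

/-- **Amplitudes as path sums.** For `ζ² = i` and oracle-free `gs`:
`⟨z| prodZeta ζ gs |w⟩ = 2^{-h/2} ∑_{b} pathTerm ζ gs w z b`.
[cite: AdlemanDeMarraisHuang1997, §6 (p. 1535–1536, amp_{α,t,C}(u) = Σ_p Σ_i (a_{p,i}/d^t) β^i)] -/
theorem prodZeta_mulVec_basisState_apply (hζ : ζ ^ 2 = Complex.I)
    (gs : List (QGate cliffordT N)) (hgs : ∀ g ∈ gs, g.IsOracleFree) (w z : QReg N) :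
    (prodZeta ζ gs *ᵥ basisState w) z =
      invSqrt2 ^ hCount gs * ∑ b : Fin gs.length → Bool, pathTerm ζ gs w z (List.ofFn b) := by
  rw [prodZeta_mulVec_basisState ζ hζ gs hgs w, Finset.sum_apply, Finset.mul_sum]
  exact Finset.sum_congr rfl fun b _ => pathAmp_apply ζ gs w _ z

end PathSum

/-! ### Unitarity of the `ζ`-semantics -/

section Unitary

variable {ζ : ℂ}

/-- `diag(1, ζ)` is unitary for `|ζ| = 1`. [Nielsen–Chuang 2010, §4.2] [folklore] -/
theorem phaseGate_mem_unitaryGroup (hζ : ζ * star ζ = 1) :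
    phaseGate ζ ∈ Matrix.unitaryGroup (QReg 1) ℂ := by
  have hT : phaseGate ζ = Matrix.diagonal fun x : QReg 1 => if x 0 = true then ζ else 1 := by
    ext x y
    rw [phaseGate, Matrix.of_apply, Matrix.diagonal_apply]
  rw [hT, Matrix.mem_unitaryGroup_iff, star_eq_conjTranspose, diagonal_conjTranspose,
    diagonal_mul_diagonal, ← diagonal_one]
  congr 1
  funext i
  change (if i 0 = true then ζ else 1) * star (if i 0 = true then ζ else 1) = 1
  split_ifs
  · exact hζ
  · simp

/-- Every gate is unitary in the `ζ`-semantics, `|ζ| = 1`. [folklore] -/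
theorem semZeta_mem_unitaryGroup (hζ : ζ * star ζ = 1) (g : QGate cliffordT N) :
    semZeta ζ g ∈ Matrix.unitaryGroup (QReg N) ℂ := by
  cases g with
  | oracle k e => exact QGate.toMatrix_mem_unitaryGroup_holds cliffordT_isUnitary_holds 0 _
  | gate g e =>
    cases g with
    | T => exact placeGate_mem_unitaryGroup_holds (embT e) (phaseGate_mem_unitaryGroup hζ)
    | H => exact QGate.toMatrix_mem_unitaryGroup_holds cliffordT_isUnitary_holds 0 _
    | S => exact QGate.toMatrix_mem_unitaryGroup_holds cliffordT_isUnitary_holds 0 _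
    | CNOT => exact QGate.toMatrix_mem_unitaryGroup_holds cliffordT_isUnitary_holds 0 _

/-- The `ζ`-semantics of a gate list is unitary, `|ζ| = 1`. [folklore] -/
theorem prodZeta_mem_unitaryGroup (hζ : ζ * star ζ = 1) (gs : List (QGate cliffordT N)) :
    prodZeta ζ gs ∈ Matrix.unitaryGroup (QReg N) ℂ := by
  unfold prodZeta
  refine list_prod_mem fun M hM => ?_
  rw [List.mem_reverse, List.mem_map] at hM
  obtain ⟨g, -, rfl⟩ := hM
  exact semZeta_mem_unitaryGroup hζ g

/-- The output of the `ζ`-semantics on a basis state is a unit vector, `|ζ| = 1`: its squared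
amplitudes sum to `1`. [Nielsen–Chuang 2010, §2.2.5] [folklore] -/
theorem normSq_prodZeta_mulVec_basisState (hζ : ζ * star ζ = 1) (gs : List (QGate cliffordT N))
    (w : QReg N) : normSq (prodZeta ζ gs *ᵥ basisState w) = 1 := by
  rw [normSq_mulVec_of_mem_unitaryGroup (prodZeta_mem_unitaryGroup hζ gs), normSq_basisState]

end Unitary

/-! ### The eighth root of unity: conjugate, real parts of its powers -/

/-- `ω ω̄ = 1`. [folklore] -/
theorem omega_mul_star : omega * star omega = 1 := by
  have h : omega = Complex.exp (((Real.pi / 4 : ℝ) : ℂ) * Complex.I) := by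
    simp only [omega]; push_cast; ring_nf
  rw [h, Complex.star_def, ← Complex.exp_conj, ← Complex.exp_add, map_mul, Complex.conj_ofReal,
    Complex.conj_I]
  simp

/-- `ω̄ = ω⁷`. [folklore] -/
theorem star_omega : star omega = omega ^ 7 := by
  have h : star omega = star omega * omega ^ 8 := by rw [omega_pow_eight, mul_one]
  rw [h, show (8 : ℕ) = 1 + 7 from rfl, pow_add, pow_one, ← mul_assoc, mul_comm (star omega),
    omega_mul_star, one_mul]

/-- `(ω⁵)² = i`. [folklore] -/
theorem omega5_pow_two : (omega ^ 5) ^ 2 = Complex.I := by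
  rw [← pow_mul, show 5 * 2 = 8 + 2 from rfl, pow_add, omega_pow_eight, one_mul, omega_pow_two]

/-- `ω⁵ · conj(ω⁵) = 1`. [folklore] -/
theorem omega5_mul_star : omega ^ 5 * star (omega ^ 5) = 1 := by
  rw [star_pow, ← mul_pow, omega_mul_star, one_pow]

/-- `(ω⁵)⁸ = 1`. [folklore] -/
theorem omega5_pow_eight : (omega ^ 5) ^ 8 = 1 := by
  rw [← pow_mul, show 5 * 8 = 8 * 5 from rfl, pow_mul, omega_pow_eight, one_pow]

/-- `conj(ω⁵) = (ω⁵)⁷`. [folklore] -/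
theorem star_omega5 : star (omega ^ 5) = (omega ^ 5) ^ 7 := by
  rw [star_pow, star_omega, ← pow_mul, ← pow_mul]

/-- `ω = cos(π/4) + i sin(π/4) = √2/2 + i √2/2`. [folklore] -/
theorem omega_eq_sqrt : omega = ((Real.sqrt 2 / 2 : ℝ) : ℂ) + ((Real.sqrt 2 / 2 : ℝ) : ℂ) * Complex.I := by
  have h : omega = Complex.exp (((Real.pi / 4 : ℝ) : ℂ) * Complex.I) := by
    simp only [omega]; push_cast; ring_nf
  rw [h, Complex.exp_mul_I, ← Complex.ofReal_cos, ← Complex.ofReal_sin, Real.cos_pi_div_four,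
    Real.sin_pi_div_four]

/-- `Re ω = √2/2`. [folklore] -/
theorem omega_re : omega.re = Real.sqrt 2 / 2 := by
  rw [omega_eq_sqrt]; simp

/-- `Im ω = √2/2`. [folklore] -/
theorem omega_im : omega.im = Real.sqrt 2 / 2 := by
  rw [omega_eq_sqrt]; simp

/-- The integer part of `Re(ω^d)`, `d mod 8`: `1` at `0`, `-1` at `4`, else `0`. [folklore] -/
def reA : ℕ → ℤ
  | 0 => 1
  | 4 => -1
  | _ => 0

/-- The `√2/2`-part of `Re(ω^d)`, `d mod 8`: `1` at `1, 7`, `-1` at `3, 5`, else `0`. [folklore] -/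
def reB : ℕ → ℤ
  | 1 => 1
  | 3 => -1
  | 5 => -1
  | 7 => 1
  | _ => 0

/-- `Re(ω^d) = reA d + reB d · √2/2` for `d < 8` (`cos(dπ/4)`). [folklore] -/
theorem omega_pow_re (d : ℕ) (hd : d < 8) :
    (omega ^ d).re = reA d + reB d * (Real.sqrt 2 / 2) := by
  have h3 : omega ^ 3 = Complex.I * omega := by
    rw [pow_succ, omega_pow_two]
  have h5 : omega ^ 5 = -omega := by
    rw [pow_succ, omega_pow_four]; ring
  have h6 : omega ^ 6 = -Complex.I := by
    rw [show (6 : ℕ) = 4 + 2 from rfl, pow_add, omega_pow_four, omega_pow_two]; ring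
  have h7 : omega ^ 7 = -(Complex.I * omega) := by
    rw [show (7 : ℕ) = 4 + 3 from rfl, pow_add, omega_pow_four, h3]; ring
  interval_cases d
  · simp [reA, reB]
  · simp [reA, reB, omega_re]
  · simp [reA, reB, omega_pow_two]
  · rw [h3]; simp [reA, reB, omega_im]
  · rw [omega_pow_four]; simp [reA, reB]
  · rw [h5]; simp [reA, reB, omega_re]
  · rw [h6]; simp [reA, reB]
  · rw [h7]; simp [reA, reB, omega_im]

/-- `Re((ω⁵)^d) = reA d - reB d · √2/2` for `d < 8`: the Galois conjugate `√2 ↦ -√2`. [folklore] -/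
theorem omega5_pow_re (d : ℕ) (hd : d < 8) :
    ((omega ^ 5) ^ d).re = reA d - reB d * (Real.sqrt 2 / 2) := by
  rw [← pow_mul, ← omega_pow_mod_eight]
  interval_cases d
  · simp [reA, reB]
  · rw [show 5 * 1 % 8 = 5 from rfl, omega_pow_re 5 (by norm_num)]; simp [reA, reB]
  · rw [show 5 * 2 % 8 = 2 from rfl, omega_pow_re 2 (by norm_num)]; simp [reA, reB]
  · rw [show 5 * 3 % 8 = 7 from rfl, omega_pow_re 7 (by norm_num)]; simp [reA, reB]
  · rw [show 5 * 4 % 8 = 4 from rfl, omega_pow_re 4 (by norm_num)]; simp [reA, reB]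
  · rw [show 5 * 5 % 8 = 1 from rfl, omega_pow_re 1 (by norm_num)]; simp [reA, reB]
  · rw [show 5 * 6 % 8 = 6 from rfl, omega_pow_re 6 (by norm_num)]; simp [reA, reB]
  · rw [show 5 * 7 % 8 = 3 from rfl, omega_pow_re 3 (by norm_num)]; simp [reA, reB]

/-! ### Squared amplitudes as sums over pairs of paths -/

section Pairs

/-- The **phase-difference class** of a pair of paths from `|w⟩` through `gs` that both end at
`z`: `(φ − φ') mod 8` (written `(φ + 7φ') mod 8` in `ℕ`), or `none` if either path is invalid
or does not end at `z`. These are the pairs `P₁, P₂ ∈ P_{x,t,C}` over which the yes/no count of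
the Adleman–DeMarrais–Huang machine is a sum.
[cite: AdlemanDeMarraisHuang1997, §6 Lemma 6.10 (proof: pairs of paths P₁, P₂ with C₁ = C₂)] -/
def pairDiff (gs : List (QGate cliffordT N)) (w z : QReg N) (bs bs' : List Bool) : Option ℕ :=
  match pathRun gs w bs, pathRun gs w bs' with
  | some (z₁, φ), some (z₂, φ') => if z₁ = z ∧ z₂ = z then some ((φ + 7 * φ') % 8) else none
  | _, _ => none

/-- Phase-difference classes are residues mod `8`. [folklore] -/
theorem lt_of_pairDiff_eq_some {gs : List (QGate cliffordT N)} {w z : QReg N} {bs bs' : List Bool}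
    {d : ℕ} (h : pairDiff gs w z bs bs' = some d) : d < 8 := by
  unfold pairDiff at h
  rcases h1 : pathRun gs w bs with _ | ⟨z₁, φ⟩ <;> rcases h2 : pathRun gs w bs' with _ | ⟨z₂, φ'⟩ <;>
    simp only [h1, h2] at h
  · exact absurd h (by simp)
  · exact absurd h (by simp)
  · exact absurd h (by simp)
  · by_cases hz : z₁ = z ∧ z₂ = z
    · rw [if_pos hz, Option.some.injEq] at h
      omega
    · rw [if_neg hz] at h
      exact absurd h (by simp)

/-- The integer part of the pair sum at `z`: `∑_{(b,b')} reA (pairDiff b b')`.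
[cite: AdlemanDeMarraisHuang1997, §6 Lemma 6.10 (proof: Σ_{P₁,P₂} a_{P₁,0} a_{P₂,0})] -/
def pairSumA (gs : List (QGate cliffordT N)) (w z : QReg N) : ℤ :=
  ∑ b : Fin gs.length → Bool, ∑ b' : Fin gs.length → Bool,
    match pairDiff gs w z (List.ofFn b) (List.ofFn b') with
    | some d => reA d
    | none => 0

/-- The `√2/2`-part of the pair sum at `z`: `∑_{(b,b')} reB (pairDiff b b')`.
[cite: AdlemanDeMarraisHuang1997, §6 Lemma 6.10 (proof: Σ_{P₁,P₂} a_{P₁,0} a_{P₂,0})] -/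
def pairSumB (gs : List (QGate cliffordT N)) (w z : QReg N) : ℤ :=
  ∑ b : Fin gs.length → Bool, ∑ b' : Fin gs.length → Bool,
    match pairDiff gs w z (List.ofFn b) (List.ofFn b') with
    | some d => reB d
    | none => 0

variable {ζ : ℂ}

/-- Exponents of an eighth root of unity only matter modulo `8`. [folklore] -/
theorem zeta_pow_mod_eight (h8 : ζ ^ 8 = 1) (n : ℕ) : ζ ^ (n % 8) = ζ ^ n := by
  conv_rhs => rw [← Nat.mod_add_div n 8, pow_add, pow_mul, h8, one_pow, mul_one]

/-- The product of a path term and a conjugate path term is `ζ^{pairDiff}`. [folklore] -/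
theorem pathTerm_mul_star (h8 : ζ ^ 8 = 1) (hstar : star ζ = ζ ^ 7)
    (gs : List (QGate cliffordT N)) (w z : QReg N) (bs bs' : List Bool) :
    pathTerm ζ gs w z bs * star (pathTerm ζ gs w z bs') =
      match pairDiff gs w z bs bs' with
      | some d => ζ ^ d
      | none => 0 := by
  unfold pathTerm pairDiff
  rcases pathRun gs w bs with _ | ⟨z₁, φ⟩ <;> rcases pathRun gs w bs' with _ | ⟨z₂, φ'⟩
  · simp
  · simp
  · simp
  · simp only
    by_cases h1 : z₁ = z
    · by_cases h2 : z₂ = z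
      · have hc : (z₁ = z ∧ z₂ = z) := ⟨h1, h2⟩
        rw [if_pos h1, if_pos h2, if_pos hc]
        dsimp only
        rw [star_pow, hstar, ← pow_mul, ← pow_add, zeta_pow_mod_eight h8]
      · have hc : ¬(z₁ = z ∧ z₂ = z) := fun h => h2 h.2
        rw [if_pos h1, if_neg h2, if_neg hc, star_zero, mul_zero]
    · have hc : ¬(z₁ = z ∧ z₂ = z) := fun h => h1 h.1
      rw [if_neg h1, if_neg hc, zero_mul]

/-- `‖∑ f‖² = ∑ᵢ ∑ⱼ Re(fᵢ conj fⱼ)`. [folklore] -/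
theorem norm_sum_sq_eq_sum_sum_re {ι : Type*} (s : Finset ι) (f : ι → ℂ) :
    ‖∑ i ∈ s, f i‖ ^ 2 = ∑ i ∈ s, ∑ j ∈ s, (f i * star (f j)).re := by
  rw [Complex.sq_norm]
  have h : (Complex.normSq (∑ i ∈ s, f i) : ℂ) =
      (∑ i ∈ s, f i) * star (∑ j ∈ s, f j) := (Complex.mul_conj _).symm
  rw [star_sum, Finset.sum_mul_sum] at h
  have h' := congrArg Complex.re h
  rw [Complex.ofReal_re] at h'
  rw [h', Complex.re_sum]
  exact Finset.sum_congr rfl fun i _ => Complex.re_sum _ _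

/-- `2^h (1/2)^h = 1` for the Hadamard normalisation. [folklore] -/
theorem two_pow_mul_norm_invSqrt2_pow_sq (h : ℕ) :
    (2 : ℝ) ^ h * ‖(invSqrt2 : ℂ) ^ h‖ ^ 2 = 1 := by
  rw [norm_invSqrt2_pow_sq, ← mul_pow]
  norm_num

/-- **Squared amplitudes as pair sums.** For an eighth root of unity `ζ` with `ζ² = i` whose
powers have real parts `Re ζ^d = reA d + ε · reB d · √2/2` (`ε = 1` for `ζ = ω`, `ε = -1` for
the conjugate `ζ = ω⁵`), and an oracle-free gate list with `h` Hadamard gates: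
`2^h · |⟨z| prodZeta ζ gs |w⟩|² = pairSumA + ε (√2/2) pairSumB`. This is the identity
"`Σ_C amp² = Σ_{P₁,P₂} a_{P₁} a_{P₂} / d^{2t}`" behind the yes/no count of the
Adleman–DeMarrais–Huang machine, for the amplitude ring `ℤ[ω]/√2^h` of Clifford+T.
[cite: AdlemanDeMarraisHuang1997, §6 Lemma 6.10 (proof, p. 1539: the count equals 2d^{2t}(Σ_{C∈C_A} amp² − Σ_{C∈C_R} amp²))] -/
theorem two_pow_mul_normSq_amp (hζ2 : ζ ^ 2 = Complex.I) (h8 : ζ ^ 8 = 1) (hstar : star ζ = ζ ^ 7)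
    {ε : ℝ} (hre : ∀ d < 8, (ζ ^ d).re = reA d + ε * reB d * (Real.sqrt 2 / 2))
    (gs : List (QGate cliffordT N)) (hgs : ∀ g ∈ gs, g.IsOracleFree) (w z : QReg N) :
    (2 : ℝ) ^ hCount gs * ‖(prodZeta ζ gs *ᵥ basisState w) z‖ ^ 2 =
      pairSumA gs w z + ε * (Real.sqrt 2 / 2) * pairSumB gs w z := by
  rw [prodZeta_mulVec_basisState_apply ζ hζ2 gs hgs w z, norm_mul, mul_pow, ← mul_assoc,
    two_pow_mul_norm_invSqrt2_pow_sq, one_mul, norm_sum_sq_eq_sum_sum_re]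
  simp only [pathTerm_mul_star h8 hstar, pairSumA, pairSumB, Int.cast_sum, Finset.mul_sum,
    ← Finset.sum_add_distrib]
  refine Finset.sum_congr rfl fun b _ => Finset.sum_congr rfl fun b' _ => ?_
  rcases hd : pairDiff gs w z (List.ofFn b) (List.ofFn b') with _ | d
  · simp
  · simp only [hre d (lt_of_pairDiff_eq_some hd)]
    ring

/-- The case `ζ = ω` (the circuit itself): `2^h |⟨z|C|w⟩|² = pairSumA + (√2/2) pairSumB`.
[cite: AdlemanDeMarraisHuang1997, §6 Lemma 6.10 (proof)] -/
theorem two_pow_mul_normSq_amp_omega (gs : List (QGate cliffordT N))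
    (hgs : ∀ g ∈ gs, g.IsOracleFree) (w z : QReg N) :
    (2 : ℝ) ^ hCount gs * ‖(prodZeta omega gs *ᵥ basisState w) z‖ ^ 2 =
      pairSumA gs w z + (Real.sqrt 2 / 2) * pairSumB gs w z := by
  have h := two_pow_mul_normSq_amp (ε := 1) omega_pow_two omega_pow_eight star_omega
    (fun d hd => by rw [omega_pow_re d hd]; ring) gs hgs w z
  rw [h]; ring

/-- The conjugate case `ζ = ω⁵`: `2^h |⟨z|C^σ|w⟩|² = pairSumA − (√2/2) pairSumB`. [folklore] -/
theorem two_pow_mul_normSq_amp_omega5 (gs : List (QGate cliffordT N))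
    (hgs : ∀ g ∈ gs, g.IsOracleFree) (w z : QReg N) :
    (2 : ℝ) ^ hCount gs * ‖(prodZeta (omega ^ 5) gs *ᵥ basisState w) z‖ ^ 2 =
      pairSumA gs w z - (Real.sqrt 2 / 2) * pairSumB gs w z := by
  have h := two_pow_mul_normSq_amp (ε := -1) omega5_pow_two omega5_pow_eight star_omega5
    (fun d hd => by rw [omega5_pow_re d hd]; ring) gs hgs w z
  rw [h]; ring

end Pairs

/-! ### The Adleman–DeMarrais–Huang count and its sign -/

section Sign

variable {M : ℕ}

/-- The sign of an outcome: `+1` if wire `0` reads `1` (the acceptance event of `BQP`), `-1`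
otherwise (and `-1` on the empty register). [cite: AdlemanDeMarraisHuang1997, §6 Lemma 6.10 (step 5: "yes" if C₁ is an accept configuration and "no" if it is a reject configuration)] -/
def accSign (z : QReg M) : ℤ :=
  if h : 0 < M then (if z ⟨0, h⟩ = true then 1 else -1) else -1

/-- The signed integer part `𝔄 = Σ_z sign(z) · pairSumA(z)` of the ADH count.
[cite: AdlemanDeMarraisHuang1997, §6 Lemma 6.10 (proof, p. 1539)] -/
def adhA (gs : List (QGate cliffordT M)) (w : QReg M) : ℤ :=
  ∑ z : QReg M, accSign z * pairSumA gs w z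

/-- The signed `√2/2`-part `𝔅 = Σ_z sign(z) · pairSumB(z)` of the ADH count.
[cite: AdlemanDeMarraisHuang1997, §6 Lemma 6.10 (proof, p. 1539)] -/
def adhB (gs : List (QGate cliffordT M)) (w : QReg M) : ℤ :=
  ∑ z : QReg M, accSign z * pairSumB gs w z

/-- **The ADH count** `W = 4𝔄 + 3𝔅`: the number of "yes" minus the number of "no" outputs
(up to a positive factor) of the path-pair machine, with the irrational weight `√2/2` of the
odd phase classes replaced by its rational approximation `3/4`.
[cite: AdlemanDeMarraisHuang1997, §6 Lemma 6.10 (proof, p. 1539: "the number of yes outputs minus the number of no outputs")] -/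
def adhW (gs : List (QGate cliffordT M)) (w : QReg M) : ℤ :=
  4 * adhA gs w + 3 * adhB gs w

/-- The probability of reading `1` on wire `0` after the `ζ`-semantics of `gs` on `|w⟩`
(`0 < M`). [folklore] -/
def probAcc (ζ : ℂ) (gs : List (QGate cliffordT M)) (w : QReg M) (hM : 0 < M) : ℝ :=
  ∑ z : QReg M, if z ⟨0, hM⟩ = true then ‖(prodZeta ζ gs *ᵥ basisState w) z‖ ^ 2 else 0

variable {ζ : ℂ}

/-- `0 ≤ probAcc`. [folklore] -/
theorem probAcc_nonneg (gs : List (QGate cliffordT M)) (w : QReg M) (hM : 0 < M) :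
    0 ≤ probAcc ζ gs w hM :=
  Finset.sum_nonneg fun z _ => by split_ifs <;> positivity

/-- `probAcc ≤ 1` for `|ζ| = 1` (a sub-sum of the squared amplitudes of a unit vector).
[folklore] -/
theorem probAcc_le_one (hζ : ζ * star ζ = 1) (gs : List (QGate cliffordT M)) (w : QReg M)
    (hM : 0 < M) : probAcc ζ gs w hM ≤ 1 := by
  rw [← normSq_prodZeta_mulVec_basisState hζ gs w, normSq]
  exact Finset.sum_le_sum fun z _ => by split_ifs <;> first | exact le_rfl | positivity

/-- **The signed pair sum is `2^h (2p − 1)`.** For `ζ` as in `two_pow_mul_normSq_amp` with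
`|ζ| = 1`: `𝔄 + ε (√2/2) 𝔅 = 2^h (2 · probAcc − 1)` (acceptance minus rejection probability,
using `Σ_z |a_z|² = 1`). [cite: AdlemanDeMarraisHuang1997, §6 Lemma 6.10 (proof, p. 1539: = 2d^{2t}(Σ_{C∈C_A} amp² − Σ_{C∈C_R} amp²))] -/
theorem adhA_add_adhB_eq (hζ2 : ζ ^ 2 = Complex.I) (h8 : ζ ^ 8 = 1) (hstar : star ζ = ζ ^ 7)
    (hζ : ζ * star ζ = 1) {ε : ℝ}
    (hre : ∀ d < 8, (ζ ^ d).re = reA d + ε * reB d * (Real.sqrt 2 / 2))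
    (gs : List (QGate cliffordT M)) (hgs : ∀ g ∈ gs, g.IsOracleFree) (w : QReg M) (hM : 0 < M) :
    (adhA gs w : ℝ) + ε * (Real.sqrt 2 / 2) * adhB gs w =
      (2 : ℝ) ^ hCount gs * (2 * probAcc ζ gs w hM - 1) := by
  have hnorm := normSq_prodZeta_mulVec_basisState hζ gs w
  rw [normSq] at hnorm
  have key : ∀ z : QReg M, (accSign z : ℝ) * ((2 : ℝ) ^ hCount gs *
      ‖(prodZeta ζ gs *ᵥ basisState w) z‖ ^ 2) =
      accSign z * (pairSumA gs w z + ε * (Real.sqrt 2 / 2) * pairSumB gs w z) := fun z => by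
    rw [two_pow_mul_normSq_amp hζ2 h8 hstar hre gs hgs w z]
  have hsum := Finset.sum_congr rfl fun z (_ : z ∈ Finset.univ) => key z
  -- left side of hsum: 2^h (Σ_acc − Σ_rej) ; right side: adhA + ε c adhB
  have hL : ∑ z : QReg M, (accSign z : ℝ) * ((2 : ℝ) ^ hCount gs *
      ‖(prodZeta ζ gs *ᵥ basisState w) z‖ ^ 2) =
      (2 : ℝ) ^ hCount gs * (2 * probAcc ζ gs w hM - 1) := by
    rw [← hnorm, probAcc, mul_sub, Finset.mul_sum, Finset.mul_sum, Finset.mul_sum,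
      ← Finset.sum_sub_distrib]
    refine Finset.sum_congr rfl fun z _ => ?_
    simp only [accSign, hM, dif_pos]
    split_ifs <;> push_cast <;> ring
  have hR : ∑ z : QReg M, (accSign z : ℝ) * (pairSumA gs w z + ε * (Real.sqrt 2 / 2) * pairSumB gs w z) =
      (adhA gs w : ℝ) + ε * (Real.sqrt 2 / 2) * adhB gs w := by
    simp only [adhA, adhB, Int.cast_sum, Int.cast_mul, Finset.mul_sum, ← Finset.sum_add_distrib]
    refine Finset.sum_congr rfl fun z _ => ?_
    ring
  rw [← hR, ← hsum, hL]

/-- `1.41 < √2`. [folklore] -/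
theorem sqrt_two_gt : (1.41 : ℝ) < Real.sqrt 2 := by
  rw [show (1.41 : ℝ) = Real.sqrt (1.41 ^ 2) by rw [Real.sqrt_sq (by norm_num)]]
  exact Real.sqrt_lt_sqrt (by norm_num) (by norm_num)

/-- `√2 < 1.42`. [folklore] -/
theorem sqrt_two_lt : Real.sqrt 2 < (1.42 : ℝ) := by
  rw [show (1.42 : ℝ) = Real.sqrt (1.42 ^ 2) by rw [Real.sqrt_sq (by norm_num)]]
  exact Real.sqrt_lt_sqrt (by norm_num) (by norm_num)

/-- **Bound on the irrational part.** `|𝔅| ≤ √2 · 2^h`: both `𝔄 + (√2/2)𝔅 = 2^h(2p − 1)` and its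
Galois conjugate `𝔄 − (√2/2)𝔅 = 2^h(2p^σ − 1)` lie in `[−2^h, 2^h]`, `p^σ` being the acceptance
probability of the (unitary) conjugate semantics `T ↦ diag(1, ω⁵)`. This replaces the reduction
to rational amplitudes (`BQP = BQP_θ`, `cos θ = 3/5`) of the printed proof. [folklore] -/
theorem abs_adhB_le (gs : List (QGate cliffordT M)) (hgs : ∀ g ∈ gs, g.IsOracleFree) (w : QReg M)
    (hM : 0 < M) : |(adhB gs w : ℝ)| ≤ Real.sqrt 2 * (2 : ℝ) ^ hCount gs := by
  have h1 := adhA_add_adhB_eq (ε := 1) omega_pow_two omega_pow_eight star_omega omega_mul_star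
    (fun d hd => by rw [omega_pow_re d hd]; ring) gs hgs w hM
  have h5 := adhA_add_adhB_eq (ε := -1) omega5_pow_two omega5_pow_eight star_omega5
    omega5_mul_star (fun d hd => by rw [omega5_pow_re d hd]; ring) gs hgs w hM
  have p1 := probAcc_nonneg (ζ := omega) gs w hM
  have p1' := probAcc_le_one omega_mul_star gs w hM
  have p5 := probAcc_nonneg (ζ := omega ^ 5) gs w hM
  have p5' := probAcc_le_one omega5_mul_star gs w hM
  have hpow : (0 : ℝ) < (2 : ℝ) ^ hCount gs := by positivity
  have hs := sqrt_two_gt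
  have hsq : Real.sqrt 2 * Real.sqrt 2 = 2 := Real.mul_self_sqrt (by norm_num)
  rw [abs_le]
  constructor <;> nlinarith

/-- **Sign of the ADH count, accepting case.** If the circuit accepts `|w⟩` with probability
`≥ 2/3` then `W = 4𝔄 + 3𝔅 > 0`: `W = 4 · 2^h (2p − 1) + (3 − 2√2) 𝔅 ≥ 2^h (16/3 − 3√2) > 0`.
[cite: AdlemanDeMarraisHuang1997, §6 Lemma 6.10 (proof, p. 1539: "If x ∈ S, then x is accepted with probability greater than 2/3 … so the above sum is greater than 0")] -/
theorem adhW_pos (gs : List (QGate cliffordT M)) (hgs : ∀ g ∈ gs, g.IsOracleFree) (w : QReg M)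
    (hM : 0 < M) (hp : 2 / 3 ≤ probAcc omega gs w hM) : 0 < adhW gs w := by
  have h1 := adhA_add_adhB_eq (ε := 1) omega_pow_two omega_pow_eight star_omega omega_mul_star
    (fun d hd => by rw [omega_pow_re d hd]; ring) gs hgs w hM
  have hB := abs_le.1 (abs_adhB_le gs hgs w hM)
  have hpow : (0 : ℝ) < (2 : ℝ) ^ hCount gs := by positivity
  have hs := sqrt_two_gt
  have hs' := sqrt_two_lt
  have hsq : Real.sqrt 2 * Real.sqrt 2 = 2 := Real.mul_self_sqrt (by norm_num)
  have key : (0 : ℝ) < 4 * adhA gs w + 3 * adhB gs w := by nlinarith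
  unfold adhW
  exact_mod_cast key

/-- **Sign of the ADH count, rejecting case.** If the circuit accepts `|w⟩` with probability
`≤ 1/3` then `W = 4𝔄 + 3𝔅 < 0`. [cite: AdlemanDeMarraisHuang1997, §6 Lemma 6.10 (proof, p. 1539: "If x ∉ S … the above sum is less than 0")] -/
theorem adhW_neg (gs : List (QGate cliffordT M)) (hgs : ∀ g ∈ gs, g.IsOracleFree) (w : QReg M)
    (hM : 0 < M) (hp : probAcc omega gs w hM ≤ 1 / 3) : adhW gs w < 0 := by
  have h1 := adhA_add_adhB_eq (ε := 1) omega_pow_two omega_pow_eight star_omega omega_mul_star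
    (fun d hd => by rw [omega_pow_re d hd]; ring) gs hgs w hM
  have hB := abs_le.1 (abs_adhB_le gs hgs w hM)
  have hpow : (0 : ℝ) < (2 : ℝ) ^ hCount gs := by positivity
  have hs := sqrt_two_gt
  have hs' := sqrt_two_lt
  have hsq : Real.sqrt 2 * Real.sqrt 2 = 2 := Real.mul_self_sqrt (by norm_num)
  have key : (4 * adhA gs w + 3 * adhB gs w : ℝ) < 0 := by nlinarith
  unfold adhW
  exact_mod_cast key

end Sign

end Literature.Computability.QuantumComplexity
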